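import Summits.AtomisticToContinuum.HydrodynamicLimit.Theorems.JParityClosureParityRigidity
import Summits.AtomisticToContinuum.HydrodynamicLimit.Theorems.JParityClosureParityBandClosureIsotropyOfDiracOrMaxwellian
import HarnessLib

/-!
# Identically vanishing even production forces isotropic central second moments
(stub `stub_isotropyOfVanishingProduction`)

Helper for the line `Sketch` of the crux `JParityClosure.ParityBandClosure` (stmt-AtomisticToContinuum-17608),
sub-goal of the skeleton stub `stub_isotropyOfMaxwellDefect`.  The route support `JParityClosure.ParityRigidity`
(proved: `parityRigidity_proof`) says that a probability measure `m` on `ℝ³` with finite second moment whose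
`ϑ`-Gaussian mollification `h_ϑ = m ⋆ G_{ϑ²}` has even entropy production (against the ideal hard-sphere contact law,
integrated against `m ⊗ m`) tending to `0` as `ϑ → 0⁺` is a point mass or a Maxwellian law.  The line's Young-measure
step produces the stronger hypothesis that this production VANISHES IDENTICALLY for all `ϑ ∈ (0, ϑ₀)`; a function that
is `0` on `(0, ϑ₀)` tends to `0` along `𝓝[>] 0` (`Ioo 0 ϑ₀ ∈ 𝓝[>] 0`), so `parityRigidity_proof` applies, and the
sibling helper `ParityBandClosureIsotropy.stub_isotropyOfDiracOrMaxwellian` (moments of a point mass / a Maxwellian)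
yields a mean `u` and an isotropic central second-moment tensor `θ 𝟙`, `θ ≥ 0`.

References: C. Cercignani, R. Illner, M. Pulvirenti, *The Mathematical Theory of Dilute Gases* (1994) §3.2.
-/

noncomputable section

namespace Summit.AtomisticToContinuum.HydrodynamicLimit.Theorems.ParityBandClosureIsotropy

open scoped BigOperators ENNReal
open MeasureTheory
open Literature.MathematicalPhysics.KineticTheory Literature.Analysis.FluidPDE
open Summit.AtomisticToContinuum.HydrodynamicLimit.Theses

/-- **Isotropy from identically vanishing even production.**  Let `m` be a probability measure on `ℝ³` with finite
second moment, `h_ϑ = m ⋆ G_{ϑ²}` its `ϑ`-Gaussian mollification and `F_ϑ` the surprisal jump of `h_ϑ` across an ideal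
hard-sphere collision.  If the even production `∫∫ B · F_ϑ (1 - e^{-F_ϑ}) d(m ⊗ m)` vanishes for every `ϑ ∈ (0, ϑ₀)`,
then `m` has a mean `u` (`∫ v_j dm = u_j`) and isotropic central second moments
`∫ (v_j - u_j)(v_k - u_k) dm = θ δ_{jk}` for some `θ ≥ 0`: by `ParityRigidity` (`parityRigidity_proof`) `m` is a point
mass or a Maxwellian, whose moments are computed in `stub_isotropyOfDiracOrMaxwellian`. -/
theorem stub_isotropyOfVanishingProduction : ∀ (m : Measure V3) [IsProbabilityMeasure m], Integrable (fun v => ‖v‖ ^ 2) m → (let h : ℝ → V3 → ℝ := fun ϑ v => ∫ v', localMaxwellian 1 (ϑ ^ 2) v v' ∂m; let F : ℝ → Metric.sphere (0 : V3) 1 → V3 × V3 → ℝ := fun ϑ ω p => Real.log (h ϑ p.1) + Real.log (h ϑ p.2) - Real.log (h ϑ (collide ω p).1) - Real.log (h ϑ (collide ω p).2); ∃ ϑ₀ : ℝ, 0 < ϑ₀ ∧ ∀ ϑ ∈ Set.Ioo 0 ϑ₀, (∫⁻ p, ∫⁻ ω, ENNReal.ofReal (hardSphereKernel (p.2, p.1)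 ω * (F ϑ ω p * (1 - Real.exp (-F ϑ ω p)))) ∂sphereMeasure ∂(m.prod m)) = 0) → ∃ θ : ℝ, 0 ≤ θ ∧ ∃ u : V3, (∀ j : Fin 3, ∫ v, v j ∂m = u j) ∧ ∀ j k : Fin 3, ∫ v, (v j - u j) * (v k - u k) ∂m = if j = k then θ else 0 := by
  intro m _ hint hzero
  obtain ⟨ϑ₀, hϑ₀, hz⟩ := hzero
  -- `ParityRigidity` needs the production to tend to `0` as `ϑ → 0⁺`; it is identically `0` on `(0, ϑ₀) ∈ 𝓝[>] 0`.
  refine (stub_isotropyOfDiracOrMaxwellian m (parityRigidity_proof m hint ?_)).2.2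
  refine tendsto_const_nhds.congr' ?_
  filter_upwards [Ioo_mem_nhdsGT hϑ₀] with ϑ hϑ
  exact (hz ϑ hϑ).symm

end Summit.AtomisticToContinuum.HydrodynamicLimit.Theorems.ParityBandClosureIsotropy

end
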